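import Summits.CriticalPhenomena.PercolationContinuityZ3.Theorems.PercAnnulusCrossingSlabRSWCase3
import Literature.Probability.Percolation.SlabRSWLemma316
import HarnessLib

/-!
# RSW3 lane (p2 GEN 40): NTW's Theorem 3.1 at `p_c(S_k)` reduced to ONE local construction — gadgets in
# the domain `R' ∖ 𝒩(Γ, ρ₂)` of Lemma 3.16 — and the upper bound (3.60)

builds on p205010 (kernel theorem, internal audit signed; external expert review pending) — NOT used in this file.

Cell `prim-rsw3` (LANE 3), seat p2, gen 40.  Support file (`--supports stmt-CriticalPhenomena-4575`); no definitions, no named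
facts, no sorries.  This generation's Literature port proved, for NTW's Theorem 3.14: Case 2 (`thm314_hCase2`), the exploration
of Case 3 (`GlueData.real_case3_le`, NTW (3.47)–(3.49)), the separation step (`evOff_subset_toMirror`), the crossing step of
Lemma 3.16 (`mem_evNear_mirrorGlue`) and its Harris/symmetry assembly (`h316_of_gadgets`).  Composed with the lead's
assembly (`boxCrossingProperty_slabCritical_of_cases`, GEN 36) the box-crossing property at `p_c(S_k)` now rests on exactly
two inputs:

* `boxCrossingProperty_slabCritical_of_gadgets` — for `k ≥ 1`, `ρ ≥ 2`... precisely: radii `ρ`, `r`, `ρ₂ ≥ 2`, a threshold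
  `n₀`: (G) for `n ≥ n₀`, every admissible lattice configuration `ω` of the reflected frame and every lattice configuration
  `ω'` of `Q₁.evXn ρ` (`Q₁ = NTW17.mirrorGlue n (Γ ω) ρ₂`) there is a local modification `NTW17.GadgetSpec Q₁ k r ω' ω''`
  AT `p_c(S_k)`-independent level (purely combinatorial); and (H360) `f_{p_c}(n,2n) ≤ 1 - c₂`.  Then
  `NTW17.BoxCrossingProperty k (p_c(S_k))`.

(G) is NTW's "the domain `K_□` is regular enough to apply Theorem 3.6" (Remark 2 after Thm 3.7) for the domain
`R' ∖ 𝒩(Γ, ρ₂)`; the tree's gadget constructions (`SlabRSWGluingGeometry/Segment/Ext/ExtB`) cover rectangles only.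

References: C. M. Newman, V. Tassion, W. Wu, *Critical percolation and the minimal spanning tree in slabs*, Comm. Pure Appl. Math. 70
(2017) = arXiv:1512.09107, §3.5 (Theorem 3.14, Case 3; Lemma 3.16), §3.2 (Theorem 3.6/3.7, Remark 2), §3.7 [NewmanTassionWu2017].
-/

noncomputable section

namespace Summit.CriticalPhenomena.PercolationContinuityZ3.Theorems.Crossing

open MeasureTheory
open Literature.Probability.Percolation Literature.Probability.LatticeModels
open Literature.Probability.Percolation.NTW17

/-- **NTW's Theorem 3.1 at `p_c(S_k)` from local gadgets in `R' ∖ 𝒩(Γ, ρ₂)` and the upper bound (3.60).**  For `k ≥ 1`,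
radii `ρ`, `r`, `ρ₂ ≥ 2` and a threshold `n₀`: if (G) every lattice configuration `ω'` of `Q₁.evXn ρ`,
`Q₁ = mirrorGlue n (Γ(ω)) ρ₂` for `n ≥ n₀` and an admissible lattice `ω` (`A ⟷^{S'} B` in the reflected frame
`case2Setup n`), admits a local modification `GadgetSpec Q₁ k r ω' ω''`, and (H360) `f_{p_c(S_k)}(n,2n) ≤ 1 - c₂` for
`n ≥ 1`, then the box-crossing property holds at `p_c(S_k)`.
[cite: NewmanTassionWu2017, Theorem 3.1, Theorem 3.14 (Case 3), Lemma 3.16, Theorem 3.6 (Remark 2) and §3.7] -/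
theorem boxCrossingProperty_slabCritical_of_gadgets (k : ℕ) (hk : 1 ≤ k) {ρ r ρ₂ n₀ : ℕ} (hρ₂ : 2 ≤ ρ₂)
    (hgad : ∀ (n : ℕ) (hn : 1 ≤ n), n₀ ≤ n → ∀ ω : BondConfig (slab 3 k), ω ⊆ (slabGraph 3 k).edgeSet →
      ω ∈ (case2Setup n hn).Q.evAB k → ∀ ω' : BondConfig (slab 3 k), ω' ⊆ (slabGraph 3 k).edgeSet →
      ω' ∈ (mirrorGlue n hn ((case2Setup n hn).Q.γ k ω) ρ₂).evXn k ρ →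
      ∃ ω'', GadgetSpec (mirrorGlue n hn ((case2Setup n hn).Q.γ k ω) ρ₂) k r ω' ω'')
    (h360 : ∃ c₂ : ℝ, 0 < c₂ ∧ ∀ n : ℕ, 1 ≤ n →
      (bondPercolation (slabGraph 3 k) (criticalProbIOf (slabGraph 3 k) (slabOrigin 3 k))).real
        (slabConn k (boxR 0 n 0 (2 * n)) {z | z.1 = 0} {z | z.1 = n}) ≤ 1 - c₂) :
    BoxCrossingProperty k (criticalProbIOf (slabGraph 3 k) (slabOrigin 3 k)) := by
  have hpos : 0 < ((criticalProbIOf (slabGraph 3 k) (slabOrigin 3 k) : unitInterval) : ℝ) := by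
    show 0 < criticalProb (slabGraph 3 k) (slabOrigin 3 k)
    exact (criticalProb_zd_pos 3 (by norm_num)).trans
      (AizenmanGrimmett1991.criticalProb_zd_lt_criticalProb_slab_of_AG (d := 3) le_rfl k)
  have hlt : ((criticalProbIOf (slabGraph 3 k) (slabOrigin 3 k) : unitInterval) : ℝ) < 1 := by
    show criticalProb (slabGraph 3 k) (slabOrigin 3 k) < 1
    exact (Transplant.StairSlabLog.criticalProb_slab_le_half k).trans_lt (by norm_num)
  exact boxCrossingProperty_slabCritical_of_lemma316 k hk hρ₂ (h316_of_gadgets _ hpos hlt hgad) h360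

end Summit.CriticalPhenomena.PercolationContinuityZ3.Theorems.Crossing

end
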